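import Literature.NumberTheory.Sieve.HeathBrownCubicPrimes
import Literature.NumberTheory.Sieve.CircleMethod
import Literature.NumberTheory.Sieve.SieveFramework
import Mathlib.NumberTheory.Chebyshev
import Mathlib.MeasureTheory.Integral.IntervalIntegral.Basic
import Mathlib.Analysis.SpecialFunctions.Pow.Real
import HarnessLib

/-!
# Cubic-minorant circle method (rung F-P1 / parity-ideate-p2, Lines E and F) — DEFINITIONS LEAF

DEFINITIONS ONLY (nothing asserted; three one-line sanity lemmas): the objects over which the port routes of the
cell evidence files `run/shared/lean/pub/parity-ideate/parity-ideate-p2/evidence/VinogradovHeathBrown.lean`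
(Line E, namespace `ParityIdeateP2.LineE`, 5193 lines, KERNEL-PROVED target `vinogradovHeathBrown_holds`) and
`…/evidence/HeathBrownPrimeAP3.lean` (Line F, namespace `ParityIdeateP2.LineF`, 6052 lines, KERNEL-PROVED target
`heathBrownPrimeAP3_holds`; both 0 sorries, axioms `propext`/`Classical.choice`/`Quot.sound`) state their items.
Every `def` below is VERBATIM the evidence text, so that each route item `X` (the block statements E2
`RoughModelFourierApprox`, E4b `HBFourierFourthMoment`, E5 `HolderCounting`, E6 `RoughModelPairCountLower`,
E3 `MainTermLower`/`ErrorTermBound`/`Readout`, F1–F3 `MainTermLowerAP`/`ErrorTermBoundAP`/`ReadoutAP`, typed in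
the route files over these definitions) is closed by re-proving the evidence theorem `X_holds` against them.
Tree home: this Literature DEFINITIONS file (non-`Prop` plumbing definitions of standard circle-method objects —
a sifted "rough" model of the primes, weighted exponential sums and counts — tagged `[folklore]`; the three
one-line API lemmas cite the sources of the objects they concern). The route files (Theses) and the porting
provers' Theorems files import it; namespace `Literature.NumberTheory.Sieve.CubicMinorant` (the literature seat's
pre-split port texts `run/shared/lean/pub/parity-ideate/parity-ideate-lit/port/*.lean` carry duplicate `def`s
under a placeholder namespace — a porting prover deletes them in favour of `open Literature.NumberTheory.Sieve.CubicMinorant`).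
The NEW theorems themselves (targets and block statements) are obligations/theorems of the Parity summit and
live under `Summits/Parity/GeneralizedHardyLittlewood/Theorems/`, not here.

Objects: the rough model `g_z(n) = (P(z)/φ(P(z)))·1[(n, P(z)) = 1]`, `z = (log N)^B` (`roughModel`, its
exponential sum `roughExpSum`, its restriction `gWeight`); `Λ|[1,N]` (`vmWeight`); Heath-Brown's box
`X = (N/6)^{1/3}`, `η = (log X)^{−c}` (`hbX`, `hbEta`), the representation count by Heath-Brown pairs `hbRep`
(tree `CubicPrimes.primePairs`), the weight `f₃(n) = N^{1/3} log n · hbRep n` (`hbWeight`) and its exponential sum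
`hbExpSum`; the generic `expSumOf`, `ternarySum` (`∑_{n₁+n₂+n₃=N} f₁f₂f₃` over `Finset.Nat.antidiagonalTuple 3 N`);
and Line F's AP weight `apWeight c N k = f₃(N − k/2)` for even `k` (so that at scale `2N` the ternary count is
`∑_π f₃(π) ∑_{n₁+n₂=2π} Λ(n₁)Λ(n₂)`). The targets are the separate Mathlib-only leaves
`Summit.Parity.GeneralizedHardyLittlewood.VinogradovHeathBrown` / `.HeathBrownPrimeAP3`.

References: [Vaughan1997] R. C. Vaughan, *The Hardy–Littlewood method*, 2nd ed., CUP 1997, §§2–3;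
[HeathBrownActa2001] D. R. Heath-Brown, *Primes represented by x³ + 2y³*, Acta Math. 186 (2001) 1–84;
[Greaves2001] G. Greaves, *Sieves in number theory*, Springer 2001, §3.3. Written in the ideation cell
`parity-ideate` (planner seat p2, 2026-08-25).
-/

noncomputable section

open scoped ArithmeticFunction FourierTransform
open Finset MeasureTheory Filter Literature.NumberTheory.Sieve Literature.NumberTheory.Sieve.CubicPrimes

namespace Literature.NumberTheory.Sieve.CubicMinorant

/-! ### The rough model (E2, E6) -/

/-- The sifting level `z = z(N) = (log N)^B`. [folklore] -/
def roughLevel (B : ℝ) (N : ℕ) : ℝ := Real.log N ^ B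

/-- The primorial `P(z) = ∏_{p < z} p` at `z = (log N)^B` (tree: `primesProdBelow`). [folklore] -/
def roughPrimorial (B : ℝ) (N : ℕ) : ℕ := primesProdBelow (roughLevel B N)

/-- The ROUGH MODEL `g_z(n) = (P(z)/φ(P(z))) · 1[(n, P(z)) = 1]`: the normalised indicator of the
integers free of prime factors `< z = (log N)^B`. It has the same major-arc behaviour as `Λ`
(`μ(q)/φ(q) T(β)` at `a/q + β`, every `q ≤ (log N)^B`), negligible minor arcs, and is a sifted set
to which the fundamental lemma applies directly. [folklore] -/
def roughModel (B : ℝ) (N n : ℕ) : ℝ :=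
  if Nat.Coprime n (roughPrimorial B N) then
    (roughPrimorial B N : ℝ) / (Nat.totient (roughPrimorial B N) : ℝ)
  else 0

/-- `g_z ≥ 0` (immediate from the definition of the sifted model). [cite: Greaves2001, §3.3 (sifted sets; the model is a normalised indicator)] -/
theorem roughModel_nonneg (B : ℝ) (N n : ℕ) : 0 ≤ roughModel B N n := by
  unfold roughModel
  split_ifs
  · positivity
  · exact le_rfl

/-- `ĝ_z(α) = ∑_{1 ≤ n ≤ N} g_z(n) e(nα)`. [folklore] -/
def roughExpSum (B : ℝ) (N : ℕ) (α : ℝ) : ℂ :=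
  ∑ n ∈ Icc 1 N, (roughModel B N n : ℂ) * (𝐞 (n * α) : ℂ)

/-- Heath-Brown's box scale `X = (N/6)^{1/3}`, so that `x³ + 2y³ ∈ (N/2, (N/2)(1+η)³]` for
`x, y ∈ (X, X(1+η)]`. [folklore] -/
def hbX (N : ℕ) : ℝ := ((N : ℝ) / 6) ^ ((1 : ℝ) / 3)

/-- Heath-Brown's box width `η = (log X)^{−c}` (the `c` of `HeathBrown2001_primePairCount_asymptotic`). [cite: HeathBrownActa2001, Theorem 1 (the box X < x, y ≤ X(1+η) with η = (log X)^{-c})] -/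
def hbEta (c : ℝ) (N : ℕ) : ℝ := Real.log (hbX N) ^ (-c)

/-- The number of representations `n = x³ + 2y³` by Heath-Brown pairs `(x, y) ∈ primePairs X η`
(so `hbRep c N n ≠ 0` forces `n` prime, `n > 3X³ = N/2`). [folklore] -/
def hbRep (c : ℝ) (N n : ℕ) : ℕ :=
  #{xy ∈ primePairs (hbX N) (hbEta c N) | xy.1 ^ 3 + 2 * xy.2 ^ 3 = n}

/-- The weight `f₃(n) = N^{1/3} (log n) · #{(x, y) ∈ primePairs X η : x³ + 2y³ = n}`
(tree: `CubicPrimes.primePairs`), normalised to have mass `≍ η² N`. UPDATE 2026-08-25: weighted by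
the NUMBER of representing pairs rather than its indicator — the `L⁴` majorant argument (E4b) is
unchanged (it majorises by all box pairs anyway), and the mass `∑ₙ f₃(n) = N^{1/3} ∑_{pairs} log(x³+2y³)`
is then Heath-Brown's pair count verbatim, with no multiplicity / paucity lemma for
`x³ + 2y³ = x'³ + 2y'³` needed in the assembly. [folklore] -/
def hbWeight (c : ℝ) (N n : ℕ) : ℝ :=
  (N : ℝ) ^ ((1 : ℝ) / 3) * Real.log n * (hbRep c N n : ℝ)

/-- `f₃ ≥ 0` (immediate: a count times `N^{1/3} log n ≥ 0`). [cite: HeathBrownActa2001, Theorem 1 (the weight counts the prime values of x³+2y³ it enumerates)] -/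
theorem hbWeight_nonneg (c : ℝ) (N n : ℕ) : 0 ≤ hbWeight c N n := by
  unfold hbWeight
  exact mul_nonneg (mul_nonneg (by positivity) (Real.log_natCast_nonneg n)) (Nat.cast_nonneg _)

/-- `f̂₃(α) = ∑_{1 ≤ n ≤ N} f₃(n) e(nα)`. [folklore] -/
def hbExpSum (c : ℝ) (N : ℕ) (α : ℝ) : ℂ :=
  ∑ n ∈ Icc 1 N, (hbWeight c N n : ℂ) * (𝐞 (n * α) : ℂ)

/-! ### Exponential sums of a weight and the weighted ternary count -/

/-- `∑_{n ≤ N} f(n) e(nα)` for a real weight `f`. [folklore] -/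
def expSumOf (f : ℕ → ℝ) (N : ℕ) (α : ℝ) : ℂ :=
  ∑ n ∈ range (N + 1), (f n : ℂ) * (𝐞 (n * α) : ℂ)

/-- The weighted ternary count `∑_{n₁+n₂+n₃=N} f₁(n₁) f₂(n₂) f₃(n₃)` (tree pattern:
`CircleMethod.weightedTernaryCount` with `Finset.Nat.antidiagonalTuple 3 N`). [folklore] -/
def ternarySum (f₁ f₂ f₃ : ℕ → ℝ) (N : ℕ) : ℝ :=
  ∑ t ∈ Finset.Nat.antidiagonalTuple 3 N, f₁ (t 0) * f₂ (t 1) * f₃ (t 2)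

/-! ### The weights `Λ|[1,N]` and `g_z|[1,N]` -/

/-- `Λ` restricted to `[1, N]`, as a real weight on `{0, …, N}`. [folklore] -/
def vmWeight (N : ℕ) (n : ℕ) : ℝ := if n ∈ Icc 1 N then Λ n else 0

/-- `g_z` restricted to `[1, N]`. [folklore] -/
def gWeight (B : ℝ) (N : ℕ) (n : ℕ) : ℝ := if n ∈ Icc 1 N then roughModel B N n else 0

end Literature.NumberTheory.Sieve.CubicMinorant

namespace Literature.NumberTheory.Sieve.CubicMinorant

/-! ### The AP weight of Line F -/

/-- The AP weight at scale `2N`: `w(k) = f₃(N − k/2)` for even `k`, `0` for odd `k`, so that the triples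
`n₁ + n₂ + k = 2N` with `w(k) ≠ 0` are exactly `n₁ + n₂ = 2π`, `π = N − k/2` a Heath-Brown prime. [folklore] -/
def apWeight (c : ℝ) (N k : ℕ) : ℝ := if Even k then hbWeight c N (N - k / 2) else 0

/-- `w ≥ 0` (immediate from `hbWeight_nonneg`). [cite: HeathBrownActa2001, Theorem 1 (weight built from its counting function)] -/
theorem apWeight_nonneg (c : ℝ) (N k : ℕ) : 0 ≤ apWeight c N k := by
  unfold apWeight; split_ifs; exacts [hbWeight_nonneg c N _, le_rfl]

/-- Support of the AP weight: `w(k) ≠ 0 ⇒ k` even and `N − k/2` has a Heath-Brown representation. [cite: HeathBrownActa2001, Theorem 1 (weight built from its counting function)] -/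
theorem apWeight_ne_zero {c : ℝ} {N k : ℕ} (h : apWeight c N k ≠ 0) :
    Even k ∧ hbRep c N (N - k / 2) ≠ 0 := by
  unfold apWeight at h
  split_ifs at h with hk
  · refine ⟨hk, fun hr => h ?_⟩
    simp [hbWeight, hr]
  · exact absurd rfl h

end Literature.NumberTheory.Sieve.CubicMinorant

end
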